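import Summits.Langlands.Langlands.Theses.QuarterDeficit1951

/-!
# `QuarterFingerprintDeficit` (stmt-Langlands-15897) — negative lemma: the crux fails as soon as ONE of the
# even icosahedral λ = 1/4 Maass newforms that Langlands functoriality predicts at conductor 1951 exists

Line `Sketch` (card `artin-ansatz-joint-quasimode`) of crux stmt-Langlands-15897, lead seat
prover-line-stmt-Langlands-15897-0, 2026-08-16.

`Summit.Langlands.Langlands.Theses.QuarterDeficit1951.QuarterFingerprintDeficit` (C1) says: for EVERY
order-5 Dirichlet character `χ mod 1951` there is NO nonzero bounded `C²` cusp form `u` on `(Γ₀(1951), χ)`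
with `(Δ + λ)u = 0`, `|λ − 1/4| ≤ 1/100`, joint `T_p`-eigen for `p ≤ 13` with `‖μ_p² χ̄(p) − φ‖ ≤ 1/100`
for some `φ ∈ Φ = {0, 1, 4, (3 ± √5)/2}`.

`EvenIcosahedralMaassFormAt1951` (H) is what conjunct (B) of the summit statement predicts for the four
Doud–Moore even icosahedral Artin representations of conductor 1951 (DoudMoore2006; it is literally the
conclusion shape of the route's own `CorrespondentFingerprint`, stripped of its Galois hypotheses): SOME
order-5 `χ` carries a nonzero form of this kind with `λ = 1/4` EXACTLY and `μ_p² χ̄(p) ∈ Φ` EXACTLY.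
H is not constructible in the tree today (no spectral theory of `L²(Γ₀(N)\ℍ, χ)`, no certified trace
formula); the lead's kit computation (Hejhal's linear system at fixed `r = 0` on `(Γ₀(1951), χ)`, evidence
on the crux item) is where it is DECIDED numerically.

What is PROVED here (kernel-checked, no `sorry`): `H → ¬ C1` — `λ = 1/4` lies in the window and exact
fingerprint membership is within `1/100` (the same five lines as the route's deciding theorem `closes`).
-/

-- `Summit.<Summit>.<Problem>`: for the single-conjunct summit `Langlands` the duplicate is mandated.
set_option linter.dupNamespace false

namespace Summit.Langlands.Langlands.Theorems.QuarterFingerprintDeficit.Negative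

open Summit.Langlands.Langlands.Theses.QuarterDeficit1951

/-- **H — the even icosahedral λ = 1/4 Maass form at conductor 1951 exists** (what Langlands functoriality
predicts for the Doud–Moore representations; DoudMoore2006 §1, BookerLeeStrombergsson2020 Thm 2): there are an
order-5 character `χ mod 1951` and a nonzero bounded `C²` function `u : ℍ → ℂ` with `(Δ + 1/4) u = 0`,
`u (γ z) = χ(d_γ) u z` on `Γ₀(1951)`, zero constant terms at the cusps `∞` (width 1) and `0` (width 1951),
and, for `p ∈ {2,3,5,7,11,13}`, `T_p u = μ_p u` for the classical unitary Hecke operator with nebentypus `χ`,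
with `μ_p² · χ̄(p) ∈ Φ = {0, 1, 4, (3 ± √5)/2}` EXACTLY (the projective icosahedral fingerprint: order of
`Frob_p` in `A₅` ↦ `4, 0, 1, (3 ± √5)/2`). The `let`s are VERBATIM those of the route decl. A CONSTRUCTION
hypothesis, decided numerically by the crux item's kit evidence; not a published theorem. -/
def EvenIcosahedralMaassFormAt1951 : Prop :=
  let Φ : Set ℂ := {0, 1, 4, (((3 + Real.sqrt 5) / 2 : ℝ) : ℂ), (((3 - Real.sqrt 5) / 2 : ℝ) : ℂ)}; let P₀ : Finset ℕ := {2, 3, 5, 7, 11, 13}; let IsForm : DirichletCharacter ℂ 1951 → (UpperHalfPlane → ℂ) → ℝ → Prop := fun χ u lam => Literature.NumberTheory.Automorphic.IsC2 u ∧ (∀ z, Literature.NumberTheory.Automorphic.hypLaplacian u z + (lam : ℂ) * u z = 0) ∧ (∀ γ : Matrix.SpecialLinearGroup (Fin 2) ℤ, γ ∈ CongruenceSubgroup.Gamma0 1951 → ∀ z : UpperHalfPlane, u (γ • z) = χ ((γ 1 1 : ℤ) : ZMod 1951) * u z) ∧ (∀ y : ℝ, 0 < y → ∫ x in (0 : ℝ)..1,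 u (UpperHalfPlane.ofComplex (x + y * Complex.I)) = 0) ∧ (∀ y : ℝ, 0 < y → ∫ x in (0 : ℝ)..1951, u (ModularGroup.S • UpperHalfPlane.ofComplex (x + y * Complex.I)) = 0) ∧ (∃ C : ℝ, ∀ z, ‖u z‖ ≤ C); let Tp : DirichletCharacter ℂ 1951 → ℕ → (UpperHalfPlane → ℂ) → UpperHalfPlane → ℂ := fun χ p u z => ((Real.sqrt p : ℝ) : ℂ)⁻¹ * ((∑ b ∈ Finset.range p, u (UpperHalfPlane.ofComplex (((z : ℂ) + b) / p))) + χ (p : ZMod 1951) * u (UpperHalfPlane.ofComplex ((p : ℂ) * z))); ∃ χ : DirichletCharacter ℂ 1951, orderOf χ = 5 ∧ ∃ u : UpperHalfPlane → ℂ, IsForm χ u (1 / 4) ∧ (∃ z, u z ≠ 0) ∧ ∀ p ∈ P₀, ∃ μ φ : ℂ, φ ∈ Φ ∧ (∀ z, Tp χ p u z = μ * u z) ∧ μ ^ 2 * (starRingEnd ℂ) (χ (p : ZMod 1951)) = φ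

/-- **`QuarterFingerprintDeficit` is false modulo H.** If one even icosahedral `λ = 1/4` Maass form at
`(1951, χ)`, `χ` of order 5, exists with the exact projective fingerprint at `p ≤ 13`
(`EvenIcosahedralMaassFormAt1951`), then the crux census `QuarterFingerprintDeficit` fails: `λ = 1/4` is in
the window `|λ − 1/4| ≤ 1/100` and exact membership `μ_p² χ̄(p) ∈ Φ` is within `1/100`. Pure ∃-intro
against the route decl BY NAME. -/
theorem QuarterFingerprintDeficit_false_of_EvenIcosahedralMaassFormAt1951
    (H : EvenIcosahedralMaassFormAt1951) : ¬ QuarterFingerprintDeficit := by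
  intro h₁
  obtain ⟨χ, hχ, u, hform, hne, hfp⟩ := H
  refine h₁ χ hχ ⟨u, 1 / 4, hform, hne, by norm_num, fun p hp => ?_⟩
  obtain ⟨μ, φ, hφ, hT, hμ⟩ := hfp p hp
  exact ⟨μ, φ, hφ, hT, by rw [hμ, sub_self, norm_zero]; norm_num⟩

end Summit.Langlands.Langlands.Theorems.QuarterFingerprintDeficit.Negative
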